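import Summits.HodgeConjecture.HodgeConjecture.Theorems.MarkmanPartnerTransportPicardThreeK3SquaresSimilitudeTranspose
import Summits.HodgeConjecture.HodgeConjecture.Theorems.MarkmanPartnerTransportPicardThreeK3SquaresCyclotomicCM
import Summits.HodgeConjecture.HodgeConjecture.Theorems.NikulinTwinTransportRealMultiplicationGForm
import Summits.HodgeConjecture.HodgeConjecture.Theorems.PgOneCyclotomicSquaresTranscendental
import Literature.AlgebraicGeometry.Surfaces.K3HodgeTypesHolds

/-!
# Route MarkmanPartnerTransport · crux `PicardThreeK3Squares` (stmt-HodgeConjecture-19652) —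
# HC for K3 squares DESCENDS AND LIFTS along an algebraic similitude (e.g. a symplectic quotient)

Let `(X, η, p, x)`, `(Z, η_Z, p_Z, x_Z)` be marked projective K3 surfaces and `γ` an algebraic class on
`X ⊗ Z` whose action `φ = [γ]_*` (complex orientations) is rational, Hodge-type preserving, maps `T(Z)`
onto `T(X)` and scales the intersection forms there by a constant `m ≠ 0` (for `m = p ∈ {2,3}` this is
Varesco's quotient datum, the named facts `Varesco2023_quotientSimilitude_two/three_…`; no named fact
is used here). Then Varesco's cycle-induced-sector clause — equivalently HC⁴ of the square
(`…SectorIff`) — TRANSPORTS from `Z` to `X`: for a rational Hodge endomorphism `f` of `H²(X)` killing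
`N¹(X)` with image in `T(X)`, the conjugate `f' = c⁻¹·ᵗφ ∘ f ∘ φ` (`φᵗφ = c` on `T(X)`) is such an
endomorphism of `H²(Z)`; if `f' = [γ']_*` on `T(Z)` then `f = c⁻¹·[γ ∘ γ' ∘ ᵗγ]_*` on `T(X)`. The one
non-formal input is that the TRANSPOSE `ᵗφ = [ᵗγ]_*` preserves Hodge types: it is rational hence real
(`conjClass_apply_of_isRationalClass₂`), it is the adjoint of `φ` (`traceC_transpose_cup`), and the
Hodge structure of a K3 surface is determined by its period line (`Huybrechts_K3_hodgeTypes_H2_holds`).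
(`ᵗγ` is again such a datum — for `Z` from `X`, multiplier `c²/m` — by `isOfHodgeType_transpose`,
`isRationalClass_transpose`, `transpose_mem_transcendentalSubspace` and the multiplier computation of
`…HodgeSimilitudeAlgebraic`; so the same theorem gives the converse direction. The converse is not
spelled out in this file.)

* `isOfHodgeType_transpose` — `ᵗφ` preserves every Hodge type.
* `cycleInducedSector_of_datum` — the clause for `Z` implies the clause for `X`.
* The HC⁴ form (HC⁴(Z ⊗ Z) ⟹ HC⁴(X ⊗ X), via Varesco's equivalence `…SectorIff`) is drawn in the
  companion `…QuotientDescentHodge` (kept apart so that this module stays outside the theses cone).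

No definition, no sorry. Prover seat hodge-nonav-19652-p1 (gen 5), `--supports stmt-HodgeConjecture-19652`.

References: M. Varesco, Math. Z. 305 (2023) §2; B. Kahn, *Zeta and L-functions of varieties and
motives*, §3.5.3 Lemma 3.48; D. Huybrechts, *Lectures on K3 surfaces*, Ch. 3 Lemma 3.1, Ch. 6 Prop. 1.2;
C. Voisin, *Hodge Theory I*, Cor. 6.12, Lemma 11.41.
-/

set_option linter.dupNamespace false

noncomputable section

namespace Summit.HodgeConjecture.HodgeConjecture.Theorems.MarkmanPartnerTransport.QuotientSimilitude

open scoped Manifold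
open Module CategoryTheory MonoidalCategory CartesianMonoidalCategory
open Literature.AlgebraicGeometry Literature.AlgebraicGeometry.Motives Literature.AlgebraicGeometry.HodgeTheory
open Literature.AlgebraicGeometry.Surfaces
open Literature.AlgebraicTopology.SingularHomology
open Summit.HodgeConjecture.HodgeConjecture.Theorems
open Summit.HodgeConjecture.HodgeConjecture.Theorems.NikulinTwinTransport
open Summit.HodgeConjecture.HodgeConjecture.Theorems.NikulinTwinTransport.SquareGlueFree
open Summit.HodgeConjecture.HodgeConjecture.Theorems.MarkmanPartnerTransport
open Summit.HodgeConjecture.HodgeConjecture.Theorems.MarkmanPartnerTransport.SimilitudeTranspose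

variable {S Z : SchemeOver ℂ}

/-- `MarkedK3[S, η, p, x]`: VERBATIM the `let MarkedK3 := …` binder of the route declaration
`PicardThreeK3Squares`. Local notation only. -/
local notation3 (prettyPrint := false) "MarkedK3[" S ", " η ", " p ", " x "]" =>
  (p ≠ 0 ∧ (IsIntegralClass p ∧
    (∀ q : complexBetti S (2 * 2), IsIntegralClass q → ∃ n : ℤ, q = n • p) ∧
    (∀ c : complexBetti S (2 * 1), IsIntegralClass c ↔ ∃ v : K3Index → ℤ, η c = fun i => (v i : ℂ)) ∧
    (∀ a b : complexBetti S (2 * 1),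
      cupProduct (rfl : 2 * 1 + 2 * 1 = 2 * 2) a b = k3Form (η a) (η b) • p) ∧
    IsOfHodgeType 2 S (2 * 1) 2 0 (LinearEquiv.symm η x) ∧
    (∀ τ : complexBetti S (2 * 1), IsOfHodgeType 2 S (2 * 1) 2 0 τ →
      ∃ t : ℂ, τ = t • LinearEquiv.symm η x)) ∧
    (k3Form x x = 0 ∧ 0 < (k3Form (star x) x).re ∧
      ∃ u : K3Index → ℤ, k3Form (fun i => (u i : ℂ)) x = 0 ∧ 0 < ∑ i, ∑ j, u i * k3Gram i j * u j))

/-- `Corr[μ, X, Y, hX, hY ; γ, y] = fst_* (snd^* y ∪ γ)` (`hX hY : IsSmoothProjective 2 _`). Local notation only. -/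
local notation3 (prettyPrint := false) "Corr[" μ ", " X ", " Y ", " hX ", " hY " ; " γ ", " y "]" =>
  complexGysin μ (IsSmoothProjective.tensor_holds hX hY) hX (SemiCartesianMonoidalCategory.fst X Y)
    (rfl : 2 * 1 + 2 * 2 + 2 * 2 = 2 * 1 + 2 * (2 + 2))
    (cupProduct (rfl : 2 * 1 + 2 * 2 = 2 * 1 + 2 * 2)
      (complexBetti.map (SemiCartesianMonoidalCategory.snd X Y) (2 * 1) y) γ)

/-- `Transp[X, Y ; γ] = swap^* γ`. Local notation only. -/
local notation3 (prettyPrint := false) "Transp[" X ", " Y " ; " γ "]" =>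
  complexBetti.map (CartesianMonoidalCategory.lift (SemiCartesianMonoidalCategory.snd Y X)
    (SemiCartesianMonoidalCategory.fst Y X)) (2 * 2) γ

/-- `Datum[X, Z, hX, hZ, η, ηZ ; γ, m]`: `γ` is an algebraic class on `X ⊗ Z` whose action `[γ]_*` is
rational, Hodge-type preserving, maps `T(Z)` onto `T(X)` and scales the forms there by `m` in the
markings. Local notation only. -/
local notation3 (prettyPrint := false) "Datum[" X ", " Z ", " hX ", " hZ ", " η ", " ηZ " ; " γ ", " m "]" =>
  (γ ∈ algebraicClasses (X ⊗ Z) 2 ∧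
    (∀ y, IsRationalClass y → IsRationalClass (Corr[complexOrientationFamily, X, Z, hX, hZ ; γ, y])) ∧
    (∀ (i j : ℕ) y, IsOfHodgeType 2 Z (2 * 1) i j y →
      IsOfHodgeType 2 X (2 * 1) i j (Corr[complexOrientationFamily, X, Z, hX, hZ ; γ, y])) ∧
    (∀ y ∈ transcendentalSubspace Z,
      Corr[complexOrientationFamily, X, Z, hX, hZ ; γ, y] ∈ transcendentalSubspace X) ∧
    (∀ z ∈ transcendentalSubspace X, ∃ y ∈ transcendentalSubspace Z,
      Corr[complexOrientationFamily, X, Z, hX, hZ ; γ, y] = z) ∧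
    (∀ a ∈ transcendentalSubspace Z, ∀ b ∈ transcendentalSubspace Z,
      k3Form (η (Corr[complexOrientationFamily, X, Z, hX, hZ ; γ, a]))
        (η (Corr[complexOrientationFamily, X, Z, hX, hZ ; γ, b])) = m * k3Form (ηZ a) (ηZ b)))

/-- `Sector[S, hS]`: the cycle-induced sector clause for `S` (complex orientations), VERBATIM the
hypothesis of `CycleInducedSector.hodgeConjectureFor_square_of_cycleInducedSector`. Local notation only. -/
local notation3 (prettyPrint := false) "Sector[" S ", " hS "]" =>
  (∀ (f : complexBetti S (2 * 1) →ₗ[ℂ] complexBetti S (2 * 1)),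
    (∀ y, IsRationalClass y → IsRationalClass (f y)) →
    (∀ (i j : ℕ) y, IsOfHodgeType 2 S (2 * 1) i j y → IsOfHodgeType 2 S (2 * 1) i j (f y)) →
    (∀ d ∈ algebraicClasses S 1, f d = 0) →
    (∀ y : complexBetti S (2 * 1), ∀ d ∈ algebraicClasses S 1,
      cupProduct (rfl : 2 * 1 + 2 * 1 = 2 * 2) (f y) d = 0) →
    ∃ g : complexBetti S (2 * 1) →ₗ[ℂ] complexBetti S (2 * 1),
      (∀ d ∈ algebraicClasses S 1, g d ∈ algebraicClasses S 1) ∧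
      (∃ γ ∈ algebraicClasses (S ⊗ S) 2, ∀ y : complexBetti S (2 * 1),
        g y = Corr[complexOrientationFamily, S, S, hS, hS ; γ, y]) ∧
      ∀ y : complexBetti S (2 * 1),
        (∀ d ∈ algebraicClasses S 1, cupProduct (rfl : 2 * 1 + 2 * 1 = 2 * 2) y d = 0) → f y = g y)

/-! ### Rational maps between two surfaces are real -/

/-- **A map preserving rational classes commutes with complex conjugation** (two-surface form of
`NikulinTwinTransport.conjClass_apply_of_isRationalClass`): both sides are conjugate-linear and agree on
the integral basis `η⁻¹ eⱼ` of a marking of the source. [cite: VoisinHodgeI2002, Cor. 6.12] -/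
theorem conjClass_apply_of_isRationalClass₂
    (η : complexBetti Z (2 * 1) ≃ₗ[ℂ] (K3Index → ℂ))
    (hη : ∀ c : complexBetti Z (2 * 1), IsIntegralClass c ↔ ∃ v : K3Index → ℤ, η c = fun i => (v i : ℂ))
    (φ : complexBetti Z (2 * 1) →ₗ[ℂ] complexBetti S (2 * 1))
    (hφ : ∀ x, IsRationalClass x → IsRationalClass (φ x)) (x : complexBetti Z (2 * 1)) :
    conjClass (ComplexPoints S) (2 * 1) (φ x) = φ (conjClass (ComplexPoints Z) (2 * 1) x) := by
  classical
  have hint : ∀ j : K3Index,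
      IsIntegralClass (η.symm fun i => ((Pi.single j (1 : ℤ) : K3Index → ℤ) i : ℂ)) := fun j =>
    (hη _).2 ⟨Pi.single j 1, η.apply_symm_apply _⟩
  have hx := eq_sum_smul_integralMarking_single η x
  have key : ∀ j, conjClassEquiv (ComplexPoints S) (2 * 1)
      (φ ((η x) j • η.symm (fun i => ((Pi.single j (1 : ℤ) : K3Index → ℤ) i : ℂ)))) =
      φ (conjClassEquiv (ComplexPoints Z) (2 * 1)
        ((η x) j • η.symm (fun i => ((Pi.single j (1 : ℤ) : K3Index → ℤ) i : ℂ)))) := fun j => by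
    rw [conjClassEquiv_apply, conjClassEquiv_apply, map_smul, conjClass_smul, conjClass_smul,
      map_smul, (hint j).isRationalClass.conjClass_eq,
      (hφ _ (hint j).isRationalClass).conjClass_eq]
  calc conjClass (ComplexPoints S) (2 * 1) (φ x)
      = conjClassEquiv (ComplexPoints S) (2 * 1) (φ x) := rfl
    _ = ∑ j, conjClassEquiv (ComplexPoints S) (2 * 1)
          (φ ((η x) j • η.symm (fun i => ((Pi.single j (1 : ℤ) : K3Index → ℤ) i : ℂ)))) := by
        conv_lhs => rw [hx]
        rw [map_sum, map_sum]
    _ = ∑ j, φ (conjClassEquiv (ComplexPoints Z) (2 * 1)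
          ((η x) j • η.symm (fun i => ((Pi.single j (1 : ℤ) : K3Index → ℤ) i : ℂ)))) :=
        Finset.sum_congr rfl fun j _ => key j
    _ = φ (conjClassEquiv (ComplexPoints Z) (2 * 1) x) := by
        conv_rhs => rw [hx]
        rw [map_sum, map_sum]
    _ = φ (conjClass (ComplexPoints Z) (2 * 1) x) := rfl

/-! ### The transpose of a datum preserves Hodge types -/

/-- **`ᵗφ = [ᵗγ]_*` preserves every Hodge type**, for a datum `γ` between marked projective K3
surfaces: `ᵗφ` carries the period `η⁻¹x` of `X` to a multiple of the period of `Z` (`ᵗφφ = c` on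
`T(Z)` and `φ` carries period to period, non-trivially), commutes with conjugation (rational, hence
real), and is the adjoint of the type-preserving `φ`, so it preserves orthogonality to the period and
its conjugate, i.e. the type `(1,1)` (the K3 Hodge structure is determined by its period line).
[cite: Huybrechts2016K3, Ch. 6 Prop. 1.2] [cite: Kahn2020, §3.5.3 Lemma 3.48] [cite: VoisinHodgeI2002, Cor. 6.12] -/
theorem isOfHodgeType_transpose (hS : IsK3Surface S)
    (η : complexBetti S (2 * 1) ≃ₗ[ℂ] (K3Index → ℂ)) (p : complexBetti S (2 * 2)) (x : K3Index → ℂ)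
    (hM : MarkedK3[S, η, p, x]) (hZ : IsK3Surface Z)
    (ηZ : complexBetti Z (2 * 1) ≃ₗ[ℂ] (K3Index → ℂ)) (pZ : complexBetti Z (2 * 2)) (xZ : K3Index → ℂ)
    (hMZ : MarkedK3[Z, ηZ, pZ, xZ]) {m : ℂ} (hm : m ≠ 0) (γ : complexBetti (S ⊗ Z) (2 * 2))
    (hD : Datum[S, Z, hS.1, hZ.1, η, ηZ ; γ, m]) :
    ∀ (i j : ℕ) (w : complexBetti S (2 * 1)), IsOfHodgeType 2 S (2 * 1) i j w →
      IsOfHodgeType 2 Z (2 * 1) i j (Corr[complexOrientationFamily, Z, S, hZ.1, hS.1 ; Transp[S, Z ; γ], w]) := by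
  classical
  have h4 : 2 * 1 + 2 * 1 = 2 * 2 := rfl
  have hHT : Huybrechts_K3_hodgeTypes_H2 := Huybrechts_K3_hodgeTypes_H2_holds
  obtain ⟨hp₀, ⟨hpint, -, hηint, hηcup, hx20, hxline⟩, -⟩ := id hM
  obtain ⟨hpZ0, ⟨-, -, hηZint, hηZcup, hxZ20, -⟩, -⟩ := id hMZ
  obtain ⟨-, hφrat, hφtyp, hφT, -, hφmul⟩ := hD
  set φ : complexBetti Z (2 * 1) →ₗ[ℂ] complexBetti S (2 * 1) :=
    (complexGysin complexOrientationFamily (IsSmoothProjective.tensor_holds hS.1 hZ.1) hS.1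
        (SemiCartesianMonoidalCategory.fst S Z) (rfl : 2 * 1 + 2 * 2 + 2 * 2 = 2 * 1 + 2 * (2 + 2))) ∘ₗ
      ((cupProduct (rfl : 2 * 1 + 2 * 2 = 2 * 1 + 2 * 2)).flip γ) ∘ₗ
      (complexBetti.map (SemiCartesianMonoidalCategory.snd S Z) (2 * 1)).hom with hφdef
  have hφ : ∀ y, φ y = Corr[complexOrientationFamily, S, Z, hS.1, hZ.1 ; γ, y] := fun y ↦ rfl
  set φt : complexBetti S (2 * 1) →ₗ[ℂ] complexBetti Z (2 * 1) :=
    (complexGysin complexOrientationFamily (IsSmoothProjective.tensor_holds hZ.1 hS.1) hZ.1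
        (SemiCartesianMonoidalCategory.fst Z S) (rfl : 2 * 1 + 2 * 2 + 2 * 2 = 2 * 1 + 2 * (2 + 2))) ∘ₗ
      ((cupProduct (rfl : 2 * 1 + 2 * 2 = 2 * 1 + 2 * 2)).flip (Transp[S, Z ; γ])) ∘ₗ
      (complexBetti.map (SemiCartesianMonoidalCategory.snd Z S) (2 * 1)).hom with hφtdef
  have hφt : ∀ w, φt w = Corr[complexOrientationFamily, Z, S, hZ.1, hS.1 ; Transp[S, Z ; γ], w] :=
    fun w ↦ rfl
  have hφtyp' : ∀ y, IsOfHodgeType 2 Z (2 * 1) 1 1 y →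
      IsOfHodgeType 2 S (2 * 1) 1 1 (Corr[complexOrientationFamily, S, Z, hS.1, hZ.1 ; γ, y]) :=
    fun y hy ↦ hφtyp 1 1 y hy
  have hφtrat : ∀ z, IsRationalClass z → IsRationalClass (φt z) := fun z hz ↦ by
    rw [hφt]; exact isRationalClass_transpose hS.1 hZ.1 γ hφrat hz
  set c : ℂ := m * traceC hS.1 p * (traceC hZ.1 pZ)⁻¹ with hcdef
  have hτS : traceC hS.1 p ≠ 0 := fun h ↦ hp₀ (eq_zero_of_traceC_eq_zero hS.1 h)
  have hτZ : traceC hZ.1 pZ ≠ 0 := fun h ↦ hpZ0 (eq_zero_of_traceC_eq_zero hZ.1 h)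
  have hc0 : c ≠ 0 := by
    rw [hcdef]; exact mul_ne_zero (mul_ne_zero hm hτS) (inv_ne_zero hτZ)
  have key' : ∀ y ∈ transcendentalSubspace Z, φt (φ y) = c • y := fun y hy ↦ by
    rw [hφt, hφ]
    exact transpose_comp_eq_smul hS.1 hZ.1 η p ηZ pZ hpZ0 hηcup hηZcup γ hφrat hφtyp' hφT hφmul hy
  -- the two periods
  set σ := η.symm x with hσdef
  set σZ := ηZ.symm xZ with hσZdef
  have hσ0 : σ ≠ 0 := CyclotomicCM.period_ne_zero hM
  have hσZ0 : σZ ≠ 0 := CyclotomicCM.period_ne_zero hMZ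
  have hσZT : σZ ∈ transcendentalSubspace Z :=
    (mem_transcendentalSubspace_iff_forall_algebraicClasses hZ.1 _).2
      fun d hd ↦ PgOneCyclotomicSquares.cup_eq_zero_of_twoZero hZ.1 hxZ20 hd
  obtain ⟨h1, h2, h3⟩ := hHT S hS σ hx20 hσ0
  obtain ⟨h1Z, h2Z, h3Z⟩ := hHT Z hZ σZ hxZ20 hσZ0
  -- `φ σZ = s σ`, `s ≠ 0`; `φt σ = (s⁻¹ c) σZ`
  have hφσZ : IsOfHodgeType 2 S (2 * 1) 2 0 (φ σZ) := by rw [hφ]; exact hφtyp 2 0 _ hxZ20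
  obtain ⟨s, hs⟩ := hxline _ hφσZ
  have hs0 : s ≠ 0 := by
    rintro rfl
    rw [zero_smul] at hs
    have h := key' _ hσZT
    rw [hs, map_zero] at h
    exact hσZ0 (by have := h.symm; rwa [smul_eq_zero, or_iff_right hc0] at this)
  have hline : φt σ = (s⁻¹ * c) • σZ := by
    have h := key' _ hσZT
    rw [hs, map_smul] at h
    rw [mul_smul, ← h, smul_smul, inv_mul_cancel₀ hs0, one_smul]
  -- reality of `φ` and `φt`
  have hφreal : ∀ y, conjClass (ComplexPoints S) (2 * 1) (φ y) = φ (conjClass (ComplexPoints Z) (2 * 1) y) :=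
    conjClass_apply_of_isRationalClass₂ ηZ hηZint φ (fun y hy ↦ by rw [hφ]; exact hφrat y hy)
  have hφtreal : ∀ w, conjClass (ComplexPoints Z) (2 * 1) (φt w) = φt (conjClass (ComplexPoints S) (2 * 1) w) :=
    conjClass_apply_of_isRationalClass₂ η hηint φt hφtrat
  -- adjunction: `cup (φt w) y = 0 ↔ cup (φ y) w = 0` (both `H⁴`'s are lines with non-zero trace)
  have hadj : ∀ (w : complexBetti S (2 * 1)) (y : complexBetti Z (2 * 1)),
      cupProduct h4 (φ y) w = 0 → cupProduct h4 (φt w) y = 0 := by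
    intro w y h0
    have ht := traceC_transpose_cup hS.1 hZ.1 γ w y
    rw [← hφ, ← hφt, h0, map_zero] at ht
    rw [hηZcup] at ht ⊢
    rw [map_smul, smul_eq_mul, mul_eq_zero, or_iff_left hτZ] at ht
    rw [ht, zero_smul]
  have hsymm : ∀ a b : complexBetti S (2 * 1), cupProduct h4 a b = cupProduct h4 b a := fun a b ↦ by
    rw [cupProduct_gradedComm_holds ℂ _ h4 h4]; norm_num
  intro i j w hw
  by_cases hij : i + j = 2 * 1
  · obtain ⟨rfl, rfl⟩ | ⟨rfl, rfl⟩ | ⟨rfl, rfl⟩ :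
        (i = 2 ∧ j = 0) ∨ (i = 0 ∧ j = 2) ∨ (i = 1 ∧ j = 1) := by omega
    · obtain ⟨t, rfl⟩ := (h1 w).1 hw
      rw [← hφt, map_smul, hline, smul_smul]
      exact (h1Z _).2 ⟨_, rfl⟩
    · obtain ⟨t, rfl⟩ := (h2 w).1 hw
      rw [← hφt, map_smul, ← hφtreal, hline, conjClass_smul, smul_smul]
      exact (h2Z _).2 ⟨_, rfl⟩
    · obtain ⟨hw1, hw2⟩ := (h3 w).1 hw
      rw [← hφt]
      refine (h3Z _).2 ⟨hadj w σZ ?_, hadj w _ ?_⟩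
      · rw [hs, map_smul, LinearMap.smul_apply, hsymm, hw1, smul_zero]
      · rw [← hφreal, hs, conjClass_smul, map_smul, LinearMap.smul_apply, hsymm, hw2, smul_zero]
  · obtain rfl := isOfHodgeType_eq_zero_of_add_ne hw hij
    rw [map_zero, cupProduct, LinearMap.map_zero₂, map_zero]
    obtain ⟨A⟩ := hZ.nonempty_hodgeModel
    exact IsOfHodgeType.zero A _ _ _

/-! ### Transport of the sector clause and of HC⁴ -/

/-- **The cycle-induced sector clause transports from `Z` to `X` along a datum** (module docstring:
`f ↦ f' = c⁻¹·ᵗφ f φ`, `g' ↦ g = c⁻¹·φ g' ᵗφ = c⁻¹·[γ ∘ γ' ∘ ᵗγ]_*`). [cite: Varesco2023, §2 (p. 8)]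
[cite: Kahn2020, §3.5.3 Lemma 3.48] [cite: Fulton1998, §16.1 Prop. 16.1.1] -/
theorem cycleInducedSector_of_datum (hS : IsK3Surface S)
    (η : complexBetti S (2 * 1) ≃ₗ[ℂ] (K3Index → ℂ)) (p : complexBetti S (2 * 2)) (x : K3Index → ℂ)
    (hM : MarkedK3[S, η, p, x]) (hZ : IsK3Surface Z)
    (ηZ : complexBetti Z (2 * 1) ≃ₗ[ℂ] (K3Index → ℂ)) (pZ : complexBetti Z (2 * 2)) (xZ : K3Index → ℂ)
    (hMZ : MarkedK3[Z, ηZ, pZ, xZ]) {m : ℂ} (hm : m ≠ 0) (hmrat : ∃ q : ℚ, (q : ℂ) = m)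
    (γ : complexBetti (S ⊗ Z) (2 * 2)) (hD : Datum[S, Z, hS.1, hZ.1, η, ηZ ; γ, m])
    (hsec : Sector[Z, hZ.1]) : Sector[S, hS.1] := by
  classical
  have h4 : 2 * 1 + 2 * 1 = 2 * 2 := rfl
  have hφttyp := isOfHodgeType_transpose hS η p x hM hZ ηZ pZ xZ hMZ hm γ hD
  obtain ⟨hp₀, ⟨hpint, -, hηint, hηcup, -, -⟩, -⟩ := id hM
  obtain ⟨hpZ0, ⟨hpZint, -, hηZint, hηZcup, -, -⟩, -⟩ := id hMZ
  obtain ⟨hγalg, hφrat, hφtyp, hφT, hφonto, hφmul⟩ := hD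
  set φ : complexBetti Z (2 * 1) →ₗ[ℂ] complexBetti S (2 * 1) :=
    (complexGysin complexOrientationFamily (IsSmoothProjective.tensor_holds hS.1 hZ.1) hS.1
        (SemiCartesianMonoidalCategory.fst S Z) (rfl : 2 * 1 + 2 * 2 + 2 * 2 = 2 * 1 + 2 * (2 + 2))) ∘ₗ
      ((cupProduct (rfl : 2 * 1 + 2 * 2 = 2 * 1 + 2 * 2)).flip γ) ∘ₗ
      (complexBetti.map (SemiCartesianMonoidalCategory.snd S Z) (2 * 1)).hom with hφdef
  have hφ : ∀ y, φ y = Corr[complexOrientationFamily, S, Z, hS.1, hZ.1 ; γ, y] := fun y ↦ rfl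
  set φt : complexBetti S (2 * 1) →ₗ[ℂ] complexBetti Z (2 * 1) :=
    (complexGysin complexOrientationFamily (IsSmoothProjective.tensor_holds hZ.1 hS.1) hZ.1
        (SemiCartesianMonoidalCategory.fst Z S) (rfl : 2 * 1 + 2 * 2 + 2 * 2 = 2 * 1 + 2 * (2 + 2))) ∘ₗ
      ((cupProduct (rfl : 2 * 1 + 2 * 2 = 2 * 1 + 2 * 2)).flip (Transp[S, Z ; γ])) ∘ₗ
      (complexBetti.map (SemiCartesianMonoidalCategory.snd Z S) (2 * 1)).hom with hφtdef
  have hφt : ∀ w, φt w = Corr[complexOrientationFamily, Z, S, hZ.1, hS.1 ; Transp[S, Z ; γ], w] :=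
    fun w ↦ rfl
  have hφtyp' : ∀ y, IsOfHodgeType 2 Z (2 * 1) 1 1 y →
      IsOfHodgeType 2 S (2 * 1) 1 1 (Corr[complexOrientationFamily, S, Z, hS.1, hZ.1 ; γ, y]) :=
    fun y hy ↦ hφtyp 1 1 y hy
  have hφtrat : ∀ z, IsRationalClass z → IsRationalClass (φt z) := fun z hz ↦ by
    rw [hφt]; exact isRationalClass_transpose hS.1 hZ.1 γ hφrat hz
  set c : ℂ := m * traceC hS.1 p * (traceC hZ.1 pZ)⁻¹ with hcdef
  have hτS : traceC hS.1 p ≠ 0 := fun h ↦ hp₀ (eq_zero_of_traceC_eq_zero hS.1 h)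
  have hτZ : traceC hZ.1 pZ ≠ 0 := fun h ↦ hpZ0 (eq_zero_of_traceC_eq_zero hZ.1 h)
  have hc0 : c ≠ 0 := by
    rw [hcdef]; exact mul_ne_zero (mul_ne_zero hm hτS) (inv_ne_zero hτZ)
  obtain ⟨q, hq⟩ := hmrat
  obtain ⟨p₀, hp₀eq⟩ := (isRationalClass_iff_mem_range_ofRatClass _).1 hpint.isRationalClass
  obtain ⟨pZ₀, hpZ₀eq⟩ := (isRationalClass_iff_mem_range_ofRatClass _).1 hpZint.isRationalClass
  set κ : ℚ := (q * trace hS.1 p₀ * (trace hZ.1 pZ₀)⁻¹)⁻¹ with hκdef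
  have hκ : (κ : ℂ) = c⁻¹ := by
    rw [hκdef, hcdef, ← hp₀eq, ← hpZ₀eq, traceC_ofRatClass, traceC_ofRatClass, ← hq]
    push_cast
    rfl
  have key : ∀ z ∈ transcendentalSubspace S, φ (φt z) = c • z := fun z hz ↦ by
    rw [hφt, hφ]
    exact comp_transpose_eq_smul hS.1 hZ.1 η p ηZ pZ hpZ0 hηcup hηZcup γ hφrat hφtyp' hφT hφonto hφmul hz
  have hφtT : ∀ z ∈ transcendentalSubspace S, φt z ∈ transcendentalSubspace Z := fun z hz ↦ by
    rw [hφt]; exact transpose_mem_transcendentalSubspace hS.1 hZ.1 γ hφrat hφtyp' hz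
  have hφN : ∀ n ∈ algebraicClasses Z 1, φ n ∈ algebraicClasses S 1 := fun n hn ↦
    SectorTransport.map_mem_algebraicClasses_one hS.1 hZ.1 φ (fun y hy ↦ by rw [hφ]; exact hφrat y hy)
      (fun y hy ↦ by rw [hφ]; exact hφtyp' y hy) hn
  have hφtN : ∀ n ∈ algebraicClasses S 1, φt n ∈ algebraicClasses Z 1 := fun n hn ↦
    SectorTransport.map_mem_algebraicClasses_one hZ.1 hS.1 φt hφtrat
      (fun y hy ↦ by rw [hφt]; exact hφttyp 1 1 y hy) hn
  have hmemS : ∀ y : complexBetti S (2 * 1), (∀ d ∈ algebraicClasses S 1, cupProduct h4 y d = 0) ↔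
      y ∈ transcendentalSubspace S := fun y ↦
    (mem_transcendentalSubspace_iff_forall_algebraicClasses hS.1 y).symm
  have hmemZ : ∀ y : complexBetti Z (2 * 1), (∀ d ∈ algebraicClasses Z 1, cupProduct h4 y d = 0) ↔
      y ∈ transcendentalSubspace Z := fun y ↦
    (mem_transcendentalSubspace_iff_forall_algebraicClasses hZ.1 y).symm
  -- the transport
  intro f hf₁ hf₂ hf₃ hf₄
  have hfT : ∀ y, f y ∈ transcendentalSubspace S := fun y ↦ (hmemS _).1 (hf₄ y)
  set f' : complexBetti Z (2 * 1) →ₗ[ℂ] complexBetti Z (2 * 1) := c⁻¹ • (φt ∘ₗ f ∘ₗ φ) with hf'def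
  have hf' : ∀ y, f' y = c⁻¹ • φt (f (φ y)) := fun y ↦ rfl
  obtain ⟨g', hg'N, ⟨γ', hγ'alg, hg'⟩, hf'g'⟩ := hsec f'
    (fun y hy ↦ by
      rw [hf', ← hκ]
      exact (hφtrat _ (hf₁ _ (by rw [hφ]; exact hφrat y hy))).smul _)
    (fun i j y hy ↦ (hφttyp i j _ (hf₂ i j _ (by rw [hφ]; exact hφtyp i j y hy))).smul _)
    (fun d hd ↦ by rw [hf', hf₃ _ (hφN d hd), map_zero, smul_zero])
    (fun y ↦ (hmemZ _).2 (Submodule.smul_mem _ _ (hφtT _ (hfT _))))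
  -- `g = c⁻¹ · φ ∘ g' ∘ φt = c⁻¹ · [γ ∘ γ' ∘ ᵗγ]_*`
  have hCUP := SquareOfGenerator.cupProduct_mem_algebraicClasses_tripleProduct
  obtain ⟨γ₁, hγ₁alg, hγ₁⟩ := corrComp_K3_of_cup complexOrientationFamily hCUP S Z Z hS hZ hZ γ hγalg γ' hγ'alg
  obtain ⟨γ₂, hγ₂alg, hγ₂⟩ := corrComp_K3_of_cup complexOrientationFamily hCUP S Z S hS hZ hS γ₁ hγ₁alg
    (Transp[S, Z ; γ]) (transpose_mem_algebraicClasses hS.1 hZ.1 hγalg)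
  refine ⟨c⁻¹ • (φ ∘ₗ g' ∘ₗ φt), fun d hd ↦ ?_, ⟨c⁻¹ • γ₂, Submodule.smul_mem _ _ hγ₂alg, fun y ↦ ?_⟩,
    fun y hy ↦ ?_⟩
  · exact Submodule.smul_mem _ _ (hφN _ (hg'N _ (hφtN d hd)))
  · rw [map_smul, map_smul, hγ₂ y, ← hφt, hγ₁, ← hg', ← hφ]
    rfl
  · have hyT : y ∈ transcendentalSubspace S := (hmemS y).1 hy
    have h1 : g' (φt y) = f' (φt y) := (hf'g' _ ((hmemZ _).2 (hφtT y hyT))).symm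
    have hg : (c⁻¹ • (φ ∘ₗ g' ∘ₗ φt)) y = c⁻¹ • φ (g' (φt y)) := rfl
    rw [hg, h1, hf', key y hyT, map_smul f, map_smul φt, map_smul φ, map_smul φ, key _ (hfT y), smul_smul,
      smul_smul, smul_smul]
    have h : c⁻¹ * c⁻¹ * c * c = 1 := by field_simp
    rw [h, one_smul]

end Summit.HodgeConjecture.HodgeConjecture.Theorems.MarkmanPartnerTransport.QuotientSimilitude

end
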